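import Summits.HubbardSuperconductivity.HubbardSuperconductivity.Theorems.AnisotropyChordInsertionEntropyInfrared
import Literature.Probability.LatticeModels.TorusFourierProofs

/-!
# Route `AnisotropyChord` / H0 rotor rung: the entropy route — FOURIER TOOLKIT on `(ℤ/L)²` for the
# typed infrared end (characters, orthogonality, Parseval for `kernelFT`, the density mode `ρ_k(σ)`
# inside `structureFactor`)

The theory seat's reduction `EntropyRouteReduction` (`H1 ∧ (IR_α) ∧ (S ≤ S_max) ⇒ E_J`, memo
ROTOR-THEORY-7 §93) was typed with the remark «Lean proof deferred — needs character orthogonality on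
`(ℤ/L)²`».  This file supplies that layer, in the vocabulary of
`AnisotropyChordInsertionEntropyInfrared` (`torusPhase`, `kernelFT`, `structureFactor`, `shiftConfig`):

* `torusPhase_eq_torusChar` — the typed phase `e^{2πi k·s/L}` IS the tree's character `torusChar k s`
  (`Literature.Probability.LatticeModels.TorusFourierProofs`), whence the character algebra
  (`torusPhase_add_right`, `torusPhase_sub_right`, `norm_torusPhase`) and the two orthogonality
  relations `sum_torusPhase`, `sum_torusPhase_mul_conj`;
* `sum_kernelFT_mul_conj` — Parseval for the finite Fourier transform `kernelFT` of real kernels, and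
  its working form `abs_sum_mul_le_sum_norm_kernelFT`: `|Σ_s f g| ≤ L⁻² Σ_k |f̂(k)| |ĝ(k)|`;
* `(∑ s, if σ s = 0 then torusPhase L k s else 0) = Σ_{s : σ s = 0} e^{2πi k·s/L}` (the inner sum of `structureFactor`): translation
  law `densityMode_shiftConfig`, removal of a particle `densityMode_update_one`, value at `k = 0`,
  and `structureFactor_mul`: `S_a(k) · P = Σ_σ a(σ)² |ρ_k(σ)|²`.

All statements are finite-group Fourier analysis (Friedli–Velenik 2017 §10.4); nothing here is specific
to the XXZ chain of the route.
-/

set_option linter.dupNamespace false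

noncomputable section

open Matrix Finset Filter Topology Complex
open scoped ComplexConjugate Real
open Literature.MathematicalPhysics.QuantumLattice Literature.Probability.LatticeModels

namespace Summit.HubbardSuperconductivity.HubbardSuperconductivity.Theorems.AnisotropyChord.InsertionEntropy

variable {L : ℕ} [NeZero L]

/-! ## The typed phase is the torus character -/

/-- **The typed torus phase is the tree's torus character**: `e^{2πi (Σᵢ kᵢ sᵢ)/L} = Πᵢ e(kᵢ sᵢ) = χ_k(s)`. [folklore] -/
theorem torusPhase_eq_torusChar (k s : TorusSite 2 L) : torusPhase L k s = torusChar k s := by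
  unfold torusPhase torusChar
  simp_rw [stdAddChar_mul_eq_exp]
  rw [← Complex.exp_sum]
  congr 1
  push_cast
  rw [Finset.mul_sum, Finset.sum_div]

/-- `|e^{2πi k·s/L}| = 1`. [folklore] -/
theorem norm_torusPhase (k s : TorusSite 2 L) : ‖torusPhase L k s‖ = 1 := by
  rw [torusPhase_eq_torusChar]; exact norm_torusChar k s

/-- `e^{2πi 0·s/L} = 1`. [folklore] -/
theorem torusPhase_zero_left (s : TorusSite 2 L) : torusPhase L 0 s = 1 := by
  rw [torusPhase_eq_torusChar, torusChar_zero_left]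

/-- `e^{2πi k·0/L} = 1`. [folklore] -/
theorem torusPhase_zero_right (k : TorusSite 2 L) : torusPhase L k 0 = 1 := by
  rw [torusPhase_eq_torusChar, torusChar_zero_right]

/-- Character law `φ_k(s + t) = φ_k(s) φ_k(t)`. [folklore] -/
theorem torusPhase_add_right (k s t : TorusSite 2 L) :
    torusPhase L k (s + t) = torusPhase L k s * torusPhase L k t := by
  simp_rw [torusPhase_eq_torusChar]; exact torusChar_add_right k s t

/-- `φ_k(−s) = conj φ_k(s)`. [folklore] -/
theorem torusPhase_neg_right (k s : TorusSite 2 L) :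
    torusPhase L k (-s) = conj (torusPhase L k s) := by
  simp_rw [torusPhase_eq_torusChar]; exact torusChar_neg_right k s

/-- `φ_k(s − t) = φ_k(s) conj φ_k(t)`. [folklore] -/
theorem torusPhase_sub_right (k s t : TorusSite 2 L) :
    torusPhase L k (s - t) = torusPhase L k s * conj (torusPhase L k t) := by
  simp_rw [torusPhase_eq_torusChar]; exact torusChar_sub_right k s t

/-- `φ_k(s) conj φ_k(s) = 1`. [folklore] -/
theorem torusPhase_mul_conj (k s : TorusSite 2 L) :
    torusPhase L k s * conj (torusPhase L k s) = 1 := by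
  simp_rw [torusPhase_eq_torusChar]; exact torusChar_mul_conj k s

/-- `conj φ_k(s) · φ_k(s) = 1`. [folklore] -/
theorem conj_torusPhase_mul (k s : TorusSite 2 L) :
    conj (torusPhase L k s) * torusPhase L k s = 1 := by
  rw [mul_comm]; exact torusPhase_mul_conj k s

/-- **Orthogonality (sum over the group):** `Σ_s φ_k(s) = L²` if `k = 0`, else `0`. [folklore] -/
theorem sum_torusPhase (k : TorusSite 2 L) :
    ∑ s, torusPhase L k s = if k = 0 then ((L : ℂ) ^ 2) else 0 := by
  simp_rw [torusPhase_eq_torusChar]; exact sum_torusChar_right k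

/-- **Orthogonality (sum over momenta):** `Σ_k φ_k(s) conj φ_k(t) = L²` if `s = t`, else `0`. [folklore] -/
theorem sum_torusPhase_mul_conj (s t : TorusSite 2 L) :
    ∑ k, torusPhase L k s * conj (torusPhase L k t) = if s = t then ((L : ℂ) ^ 2) else 0 := by
  simp_rw [torusPhase_eq_torusChar, ← torusChar_sub_right]
  rw [sum_torusChar_left]
  by_cases h : s = t
  · rw [if_pos h, if_pos (sub_eq_zero.mpr h)]
  · rw [if_neg h, if_neg (fun h' => h (sub_eq_zero.mp h'))]

/-! ## Parseval for `kernelFT` -/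

/-- **Parseval for the finite Fourier transform of real kernels:**
`Σ_k f̂(k) conj ĝ(k) = L² Σ_s f(s) g(s)`. [folklore] -/
theorem sum_kernelFT_mul_conj (f g : TorusSite 2 L → ℝ) :
    ∑ k, kernelFT L f k * conj (kernelFT L g k) = ((L : ℂ) ^ 2) * ∑ s, ((f s * g s : ℝ) : ℂ) := by
  unfold kernelFT
  have hk : ∀ k : TorusSite 2 L,
      (∑ s, (f s : ℂ) * torusPhase L k s) * conj (∑ t, (g t : ℂ) * torusPhase L k t)
        = ∑ s, ∑ t, (f s : ℂ) * (g t : ℂ) * (torusPhase L k s * conj (torusPhase L k t)) := by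
    intro k
    rw [map_sum, Finset.sum_mul_sum]
    refine Finset.sum_congr rfl fun s _ => Finset.sum_congr rfl fun t _ => ?_
    rw [map_mul, Complex.conj_ofReal]; ring
  simp_rw [hk]
  rw [Finset.sum_comm, Finset.mul_sum]
  refine Finset.sum_congr rfl fun s _ => ?_
  rw [Finset.sum_comm]
  simp_rw [← Finset.mul_sum, sum_torusPhase_mul_conj, mul_ite, mul_zero]
  rw [Finset.sum_ite_eq]
  simp only [Finset.mem_univ, if_true]
  push_cast; ring

/-- Parseval, real form: `Σ_s f(s) g(s) = L⁻² Re Σ_k f̂(k) conj ĝ(k)`. [folklore] -/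
theorem sum_mul_eq_re_sum_kernelFT (f g : TorusSite 2 L → ℝ) :
    ∑ s, f s * g s = (∑ k, kernelFT L f k * conj (kernelFT L g k)).re / (L : ℝ) ^ 2 := by
  have hL : (0 : ℝ) < (L : ℝ) ^ 2 := by
    have : (0 : ℝ) < (L : ℝ) := by exact_mod_cast Nat.pos_of_ne_zero (NeZero.ne L)
    positivity
  rw [sum_kernelFT_mul_conj]
  have h2 : (((L : ℂ) ^ 2) * ∑ s, ((f s * g s : ℝ) : ℂ)) = (((L : ℝ) ^ 2 * ∑ s, f s * g s : ℝ) : ℂ) := by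
    push_cast; rfl
  rw [h2, Complex.ofReal_re, mul_comm, mul_div_assoc, div_self (ne_of_gt hL), mul_one]

/-- **Working form of Parseval:** `|Σ_s f(s) g(s)| ≤ L⁻² Σ_k |f̂(k)| |ĝ(k)|`. [folklore] -/
theorem abs_sum_mul_le_sum_norm_kernelFT (f g : TorusSite 2 L → ℝ) :
    |∑ s, f s * g s| ≤ (∑ k, ‖kernelFT L f k‖ * ‖kernelFT L g k‖) / (L : ℝ) ^ 2 := by
  have hL : (0 : ℝ) < (L : ℝ) ^ 2 := by
    have : (0 : ℝ) < (L : ℝ) := by exact_mod_cast Nat.pos_of_ne_zero (NeZero.ne L)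
    positivity
  rw [sum_mul_eq_re_sum_kernelFT, abs_div, abs_of_pos hL]
  refine div_le_div_of_nonneg_right ?_ (le_of_lt hL)
  calc |(∑ k, kernelFT L f k * conj (kernelFT L g k)).re|
      ≤ ‖∑ k, kernelFT L f k * conj (kernelFT L g k)‖ := Complex.abs_re_le_norm _
    _ ≤ ∑ k, ‖kernelFT L f k * conj (kernelFT L g k)‖ := norm_sum_le _ _
    _ = ∑ k, ‖kernelFT L f k‖ * ‖kernelFT L g k‖ := by
        refine Finset.sum_congr rfl fun k _ => ?_
        rw [norm_mul, Complex.norm_conj]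

/-- `f̂(0) = Σ_s f(s)`. [folklore] -/
theorem kernelFT_zero (f : TorusSite 2 L → ℝ) : kernelFT L f 0 = ((∑ s, f s : ℝ) : ℂ) := by
  unfold kernelFT
  simp_rw [torusPhase_zero_left, mul_one]
  push_cast; rfl

/-! ## The density mode `ρ_k(σ)` -/

/-- `S_a(k) · P = Σ_σ a(σ)² |ρ_k(σ)|²` for `P ≠ 0`. [folklore] -/
theorem structureFactor_mul (a : TensorIndex (TorusSite 2 L) 2 → ℝ) {P : ℝ} (hP : P ≠ 0)
    (k : TorusSite 2 L) :
    structureFactor L a P k * P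
      = ∑ σ, a σ ^ 2 * ‖(∑ s, if σ s = 0 then torusPhase L k s else 0)‖ ^ 2 := by
  unfold structureFactor; rw [div_mul_cancel₀ _ hP]

/-- `S_a(k) ≥ 0` for `P ≥ 0`. [folklore] -/
theorem structureFactor_nonneg (a : TensorIndex (TorusSite 2 L) 2 → ℝ) {P : ℝ} (hP : 0 ≤ P)
    (k : TorusSite 2 L) : 0 ≤ structureFactor L a P k := by
  unfold structureFactor
  exact div_nonneg (Finset.sum_nonneg fun σ _ => by positivity) hP

/-- The density mode as a one-body statistic: `ρ_k(σ) = Σ_s n_s(σ) φ_k(s)`. [folklore] -/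
theorem densityMode_eq_sum_occ (σ : TensorIndex (TorusSite 2 L) 2) (k : TorusSite 2 L) :
    (∑ s, if σ s = 0 then torusPhase L k s else 0) = ∑ s, (occ σ s : ℂ) * torusPhase L k s := by
  unfold occ
  refine Finset.sum_congr rfl fun s _ => ?_
  split_ifs <;> simp

/-- At `k = 0` the density mode counts the particles. [folklore] -/
theorem densityMode_zero (σ : TensorIndex (TorusSite 2 L) 2) :
    (∑ s, if σ s = 0 then torusPhase L 0 s else 0)
      = ((Finset.univ.filter fun s => σ s = 0).card : ℂ) := by
  simp_rw [torusPhase_zero_left]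
  rw [Finset.sum_boole]

/-- `Σ_{x : σ x = 0} conj φ_k(x) = conj ρ_k(σ)`. [folklore] -/
theorem sum_ite_conj_torusPhase (σ : TensorIndex (TorusSite 2 L) 2) (k : TorusSite 2 L) :
    (∑ x, if σ x = 0 then conj (torusPhase L k x) else 0)
      = conj (∑ s, if σ s = 0 then torusPhase L k s else 0) := by
  rw [map_sum]
  refine Finset.sum_congr rfl fun x _ => ?_
  split_ifs <;> simp

/-- `ρ_k(σ) conj ρ_k(σ) = |ρ_k(σ)|²` as a real cast. [folklore] -/
theorem densityMode_mul_conj (σ : TensorIndex (TorusSite 2 L) 2) (k : TorusSite 2 L) :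
    (∑ s, if σ s = 0 then torusPhase L k s else 0) * conj (∑ s, if σ s = 0 then torusPhase L k s else 0)
      = ((‖(∑ s, if σ s = 0 then torusPhase L k s else 0)‖ ^ 2 : ℝ) : ℂ) := by
  rw [Complex.mul_conj, Complex.normSq_eq_norm_sq, Complex.ofReal_pow]

/-- **Translation law of the density mode:** `ρ_k(σ(· + v)) = conj φ_k(v) · ρ_k(σ)`. [folklore] -/
theorem densityMode_shiftConfig (v : TorusSite 2 L) (σ : TensorIndex (TorusSite 2 L) 2)
    (k : TorusSite 2 L) :
    (∑ s, if (shiftConfig L v σ) s = 0 then torusPhase L k s else 0)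
      = conj (torusPhase L k v) * (∑ s, if σ s = 0 then torusPhase L k s else 0) := by
  unfold shiftConfig
  rw [Finset.mul_sum]
  refine Fintype.sum_equiv (Equiv.addRight v) _ _ fun s => ?_
  simp only [Equiv.coe_addRight]
  split_ifs with h
  · have e : s = (s + v) - v := (add_sub_cancel_right s v).symm
    conv_lhs => rw [e]
    rw [torusPhase_sub_right]; ring
  · rw [mul_zero]

/-- **Removing a particle:** for `σ x = 0`, `ρ_k(σ with x ↦ 1) = ρ_k(σ) − φ_k(x)`. [folklore] -/
theorem densityMode_update_one (σ : TensorIndex (TorusSite 2 L) 2) (x : TorusSite 2 L) (hx : σ x = 0)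
    (k : TorusSite 2 L) :
    (∑ s, if (Function.update σ x 1) s = 0 then torusPhase L k s else 0)
      = (∑ s, if σ s = 0 then torusPhase L k s else 0) - torusPhase L k x := by
  rw [← Finset.add_sum_erase _ _ (Finset.mem_univ x), ← Finset.add_sum_erase _ _ (Finset.mem_univ x)]
  have h1 : (if Function.update σ x 1 x = 0 then torusPhase L k x else 0) = 0 := by
    rw [Function.update_self]; simp
  have h2 : (if σ x = 0 then torusPhase L k x else 0) = torusPhase L k x := if_pos hx
  have h3 : ∑ s ∈ Finset.univ.erase x, (if Function.update σ x 1 s = 0 then torusPhase L k s else 0)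
      = ∑ s ∈ Finset.univ.erase x, (if σ s = 0 then torusPhase L k s else 0) := by
    refine Finset.sum_congr rfl fun s hs => ?_
    rw [Function.update_of_ne (Finset.ne_of_mem_erase hs)]
  rw [h1, h2, h3]; ring

/-- **Adding a particle:** for `τ x = 1`, `ρ_k(τ with x ↦ 0) = ρ_k(τ) + φ_k(x)`. [folklore] -/
theorem densityMode_update_zero (τ : TensorIndex (TorusSite 2 L) 2) (x : TorusSite 2 L) (hx : τ x = 1)
    (k : TorusSite 2 L) :
    (∑ s, if (Function.update τ x 0) s = 0 then torusPhase L k s else 0)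
      = (∑ s, if τ s = 0 then torusPhase L k s else 0) + torusPhase L k x := by
  have h0 : Function.update τ x 0 x = 0 := Function.update_self ..
  have h := densityMode_update_one (Function.update τ x 0) x h0 k
  rw [Function.update_idem, ← hx, Function.update_eq_self] at h
  rw [h]; ring

/-- The transform of the one-body statistic of a law: `Σ_s φ_k(s) (Σ_τ p(τ) n_s(τ)) = Σ_τ p(τ) ρ_k(τ)`. [folklore] -/
theorem sum_torusPhase_mul_sum_occ (p : TensorIndex (TorusSite 2 L) 2 → ℝ) (k : TorusSite 2 L) :
    ∑ s, ((∑ τ, p τ * occ τ s : ℝ) : ℂ) * torusPhase L k s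
      = ∑ τ, (p τ : ℂ) * (∑ s, if τ s = 0 then torusPhase L k s else 0) := by
  simp_rw [densityMode_eq_sum_occ, Finset.mul_sum]
  rw [Finset.sum_comm]
  refine Finset.sum_congr rfl fun τ _ => ?_
  push_cast
  rw [Finset.sum_mul]
  refine Finset.sum_congr rfl fun s _ => ?_
  ring

end Summit.HubbardSuperconductivity.HubbardSuperconductivity.Theorems.AnisotropyChord.InsertionEntropy
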